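import Summits.AtomisticToContinuum.Crystallization.Theorems.PricedLinkCensusTruncatedCensusGapLandscapeCertDefs

/-!
# Landscape certificates for the near/far split of `TruncatedCensusGap` — kernel runs A (mixed-layer margin, `F_fcc` floor)

Route `PricedLinkCensus`, crux `TruncatedCensusGap` (stmt-AtomisticToContinuum-14230), line `near-far-split`
(reshape r2 of lead c5): the landscape package N1c on the class sums `F_fcc`, `F_hcp` of `V_χ` (see
`…LandscapeCertDefs`).  This file: the kernel runs (`decide +kernel`, `maxHeartbeats 0` — pure evaluation, no search) of (C2) and of the four quadrants of the `F_fcc` floor (C4).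
-/

noncomputable section

namespace Summit.AtomisticToContinuum.Crystallization.Theorems.PricedLinkCensusTruncatedCensusGap.StrainedMargin

/-! ## Kernel runs: (C2) and the `F_fcc` floor (C4) -/

set_option maxHeartbeats 0 in -- kernel evaluation of a box certificate (no proof search; bounded by the box count)
/-- **KERNEL RUN (C2)** (registered sub-goal `landscapeC2_eq_true`): the MEAN family is
`≥ refHi + 19/200000` on the whole window (173 boxes). [folklore] -/
theorem landscapeC2_eq_true : checkθ (refHi + 19 / 200000) MEAN 9 (8649 / 10000) (10404 / 10000) (6084 / 10000) (7396 / 10000) = true := by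
  decide +kernel

set_option maxHeartbeats 0 in -- kernel evaluation of a box certificate (no proof search; bounded by the box count)
/-- Kernel run: `FCC` floor (`lam = 5`, `ε = 10⁻⁶`) on the sub-box `[8649 / 10000, 19053 / 20000] × [1521 / 2500, 337 / 500]`
(113 boxes). [folklore] -/
theorem floorF_q1 : checkFloor 5 (1 / 1000000) FCC 7 (8649 / 10000) (19053 / 20000) (1521 / 2500) (337 / 500) = true := by
  decide +kernel

set_option maxHeartbeats 0 in -- kernel evaluation of a box certificate (no proof search; bounded by the box count)
/-- Kernel run: `FCC` floor (`lam = 5`, `ε = 10⁻⁶`) on the sub-box `[8649 / 10000, 19053 / 20000] × [337 / 500, 1849 / 2500]`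
(345 boxes). [folklore] -/
theorem floorF_q2 : checkFloor 5 (1 / 1000000) FCC 7 (8649 / 10000) (19053 / 20000) (337 / 500) (1849 / 2500) = true := by
  decide +kernel

set_option maxHeartbeats 0 in -- kernel evaluation of a box certificate (no proof search; bounded by the box count)
/-- Kernel run: `FCC` floor (`lam = 5`, `ε = 10⁻⁶`) on the sub-box `[19053 / 20000, 2601 / 2500] × [1521 / 2500, 337 / 500]`
(273 boxes). [folklore] -/
theorem floorF_q3 : checkFloor 5 (1 / 1000000) FCC 7 (19053 / 20000) (2601 / 2500) (1521 / 2500) (337 / 500) = true := by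
  decide +kernel

set_option maxHeartbeats 0 in -- kernel evaluation of a box certificate (no proof search; bounded by the box count)
/-- Kernel run: `FCC` floor (`lam = 5`, `ε = 10⁻⁶`) on the sub-box `[19053 / 20000, 2601 / 2500] × [337 / 500, 1849 / 2500]`
(249 boxes). [folklore] -/
theorem floorF_q4 : checkFloor 5 (1 / 1000000) FCC 7 (19053 / 20000) (2601 / 2500) (337 / 500) (1849 / 2500) = true := by
  decide +kernel


end Summit.AtomisticToContinuum.Crystallization.Theorems.PricedLinkCensusTruncatedCensusGap.StrainedMargin
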